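/-
Copyright (c) 2026 the pub-hodgecm-mathlib formalisation cell (harness21).  Prover seat hodgecm-mathlib-K2E3-p06 (g0), Track B «K2-LIT» ∕ h413,
ENGINE E3 unit U4 «Keys», SIGS-TABLE row #6 `sig_K2E3IrregularReducibleCaseThree` — helper 2 (the first conjunct `χ₁ ≠ 1`).  2026-09-03.
-/
import Summits.HodgeConjecture.HodgeConjecture.Theorems.K2E3IrregularReducibleCaseThreeJacquetScalar   -- ★ helper 1 (this seat, p855287): `normalizedJacquet_eq_smul_of_reducible_irregular`
import Summits.HodgeConjecture.HodgeConjecture.Theorems.F0P3cStCharTSKeys3AnalyticHalf                -- ★ brings D1 `…SplitTestDatum`, D2A `…AnnulusDock`, B4 `…CellFunFarOut`, ★ DICT, ★ `heisHaar`, `exists_weylElt_three`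
import Summits.HodgeConjecture.HodgeConjecture.Theorems.F0P3cStCharTSTorusRay                          -- ★ `exists_uniformizer_units`
import HarnessLib

/-!
# K2 · E3 · U4 «Keys», row #6 `sig_K2E3IrregularReducibleCaseThree` — helper 2 «`χ₁ ≠ 1`»: at a non-split `v`, a REDUCIBLE irregular (`wχ = χ`)
# principal series `i_G(χ₁, χ₂)` of `U(Φ₃)(L⁺_v)` has `χ₁ ≠ 1`, i.e. `i_G(1, χ₂)` is IRREDUCIBLE [Keys1984 §7 Thm. (1) («`λ ≠ 1`»); Rogawski1990 §12.2 (3)]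

Cell `pub/hodgecm-mathlib` (D-0151), HCML Track B «K2-LIT», crux H413 = `stmt-HodgeConjecture-24833` (lane `--supports … --as helper`), route
HCCMUnconditional; socket `sig_K2E3IrregularReducibleCaseThree` (U4-c) of `Cruxes/H413/Lines/K2_E3_EllipticInputsSigs_U4Keys.lean` (K2E3-plan (g0), frozen bytes), whose
conclusion is `χ₁ ≠ 1 ∧ ∀ a, σ a = a → χ₁ a = 1`.  THIS FILE proves the FIRST conjunct under the socket's exact binders (`chiOne_ne_one_of_reducible_irregular`).
THEOREMS ONLY (0 def ∕ 0 instance ∕ 0 notation ∕ 0 sorry); ★-only imports.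

THE MATHEMATICS (Keys' «`λ ≠ 1`» read on the open cell; the in-tree road «KEYS3-ANALYTIC» run BACKWARDS).  Suppose `χ₁ = 1` and `i_G(χ)` reducible (`wχ = χ`).  By ★ helper 1
`T` acts on `r_B i_G(χ)` by the scalar `χ`, so by the split test ★ D1 (`r_B(m)[f₀] = χ(m)[f₀] ⟺` the cell integral of `g₀(m) = δ^{-1/2}(m)·m f₀ − χ(m) f₀` vanishes) and the
annulus formula ★ D2A, for a torus element `m = d(α, ᾱα⁻¹, ᾱ⁻¹)` with `Q = ‖α‖ > 1` (§1) the integrals of the cell function `F(u) = f₀(w₀ u)` over the annuli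
`S_A = {A/Q² < ‖u₀₂‖ ≤ A}` vanish for all large `A`.  Far out ★ B4 gives `F(u) = χ₂(−1) · ‖u₀₂‖⁻¹` (here `χ₁ = 1`, `f₀(1) = 1`): a non-zero constant times a
POSITIVE function, so every large annulus is Haar-null (§2), hence so is the open set `{A⋆ < ‖u₀₂‖}` (a countable union of annuli `S_{A⋆Q^{2k}}`), which is
non-empty (§1: `u(0, α^k ᾱ^k δ)`) — absurd for a Haar measure.  (For `χ₁ = 1` the skew-line integral of the road is `∫ ‖1+η‖⁻¹ dη > 0`; this file avoids even that.)
* §1 `exists_torus_diag` (generic: `d(α, ᾱα⁻¹, ᾱ⁻¹) ∈ T` with its diagonal witness), `exists_units_one_lt_distribHaarChar` (a unit of modulus `> 1`: the inverse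
  uniformiser, ★ `exists_uniformizer_units` + ★ DICT), `exists_norm_entry_gt` (elements of `N` with `‖u₀₂‖` arbitrarily large, ★ `heisElt`).
* §2 `measure_annulus_eq_zero_of_setIntegral_eq_zero`, **`false_of_annulus_integrals_eq_zero`** — Haar measure on `N(L⁺_v)`, a function equal to `c · ‖u₀₂‖⁻¹` far out
  (`c ≠ 0`) cannot have vanishing integrals over all large annuli (★ `isCompact_normBall`, ★ `continuous_norm_entry`, Mathlib `exists_mem_Ioc_zpow`, `IsOpen.measure_pos`).
* §3 **`chiOne_ne_one_of_reducible_irregular`** — the socket's binders ⟹ `χ₁ ≠ 1`.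
HONEST LABEL: HC_CM is proved only modulo the 7 printed citations (2 remaining named inputs: hLiu418 = `stmt-HodgeConjecture-24832`, h413 =
`stmt-HodgeConjecture-24833`) until rung 0 closes; this file pays no socket by itself (the second conjunct `χ₁|_{F_v^×} = 1` — Keys' Plancherel-measure
computation for `χ₁|_{F^×} = ω_{E/F}` — remains).

## References
* [Keys1984] D. Keys, *Principal series representations of special unitary groups over local fields*, Compositio Math. 51 (1984), §3; §7 Thm. (1) p. 126.
* [Rogawski1990] J. D. Rogawski, *Automorphic Representations of Unitary Groups in Three Variables*, Ann. of Math. Stud. 123 (1990), §1.10 p. 9; §12.1 p. 171; §12.2 (3) pp. 173–174.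
* [Casselman1995] W. Casselman, *Introduction to the theory of admissible representations of p-adic reductive groups* (1995), §6.3–§6.4, Lemma 7.1.1 (a).
* [BernsteinZelevinsky1977] I. N. Bernstein, A. V. Zelevinsky, Ann. Sci. ÉNS 10 (1977), §2.3, §5 (5.2).
* [WeilBNT1967] A. Weil, *Basic Number Theory* (1967), Ch. I §2, §4.
-/

set_option autoImplicit false
-- the mandated namespace has the single-problem summit's repeated segment (`HodgeConjecture.HodgeConjecture`)
set_option linter.dupNamespace false

noncomputable section

open NumberField IsDedekindDomain MeasureTheory Set
open scoped Matrix NNReal ENNReal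
open Literature.NumberTheory.Automorphic Literature.NumberTheory.Automorphic.UnitaryGroup Literature.NumberTheory.Automorphic.UnitaryGroup.HeisRing
open Literature.NumberTheory.GaloisRepresentations Literature.NumberTheory.GaloisRepresentations.IsNonarchimedeanLocalField
open Summit.HodgeConjecture.HodgeConjecture.Cruxes.H413
open Summit.HodgeConjecture.HodgeConjecture.Cruxes.H413.F0P3cStCharTSLocalRingNormDictionary

namespace Summit.HodgeConjecture.HodgeConjecture.Cruxes.H413.K2E3IrregularReducibleCaseThreeChiOneNeOne

/-! ## §1 A torus element of modulus `> 1` and points of `N` far out -/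

section Torus

variable {R : Type*} [CommRing R] (σ : R →+* R)

/-- **The diagonal torus element `d(α, ᾱα⁻¹, ᾱ⁻¹) ∈ T ≤ U(σ, Φ₃)(R)` with its diagonal witness** (`σ` an involution; ★ `exists_torus_apply_eq`'s section with `d₀ = α`
exposed, as the annulus formula ★ D2A wants `glDiagonal 3 R d = m`). [cite: Rogawski1990, §1.10 p. 9; §12.1 p. 171] -/
theorem exists_torus_diag (hσ : ∀ x : R, σ (σ x) = x) (J₃ : Matrix (Fin 3) (Fin 3) R) (hJ : J₃ = (StdForm.antidiagonal 3).over R) (α : Rˣ) :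
    ∃ (t : ↥(torusU σ J₃)) (d : Fin 3 → Rˣ), glDiagonal 3 R d = ((t : ↥(unitaryGroupOfForm σ J₃)) : GL (Fin 3) R) ∧ d 0 = α := by
  subst hJ
  have hσu : ∀ u : Rˣ, Units.map (σ : R →* R) (Units.map (σ : R →* R) u) = u := fun u => Units.ext (hσ u)
  have hσv : ∀ u : Rˣ, σ (u : R) = ((Units.map (σ : R →* R) u : Rˣ) : R) := fun u => rfl
  let d₁ : Fin 3 → Rˣ := ![α, Units.map (σ : R →* R) α * α⁻¹, (Units.map (σ : R →* R) α)⁻¹]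
  have hd₁ : glDiagonal 3 R d₁ ∈ unitaryGroupOfForm σ ((StdForm.antidiagonal 3).over R) := by
    rw [glDiagonal_mem_unitaryGroupOfForm_antidiagonal_iff]
    intro i
    fin_cases i
    · show σ (((Units.map (σ : R →* R) α)⁻¹ : Rˣ) : R) * (α : R) = 1
      rw [hσv, map_inv, hσu, Units.inv_mul]
    · show σ ((Units.map (σ : R →* R) α * α⁻¹ : Rˣ) : R) * ((Units.map (σ : R →* R) α * α⁻¹ : Rˣ) : R) = 1
      rw [hσv, map_mul, map_inv, hσu, ← Units.val_mul, mul_assoc, inv_mul_cancel_left, mul_inv_cancel, Units.val_one]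
    · show σ ((α : Rˣ) : R) * (((Units.map (σ : R →* R) α)⁻¹ : Rˣ) : R) = 1
      rw [hσv, Units.mul_inv]
  exact ⟨⟨⟨glDiagonal 3 R d₁, hd₁⟩, ⟨d₁, rfl⟩⟩, d₁, rfl, rfl⟩

end Torus

section CMPoints

variable (L : Type) [Field L] [NumberField L] [IsCMField L] (v : HeightOneSpectrum (𝓞 ↥(maximalRealSubfield L)))
  (hns : ∀ w : PlacesOver L v, IsCMField.complexConj L • w.1 = w.1)

include hns in
/-- **A unit of `E_v` of modulus `> 1`** (`v` non-split): the inverse of a uniformiser unit (★ `exists_uniformizer_units`: `|ϖ_w|_w = exp(−1) < 1`, ★ DICT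
`unitModulusChar_lt_one_iff`). [cite: WeilBNT1967, Ch. I §4] [cite: Rogawski1990, §12.2 p. 173] -/
theorem exists_units_one_lt_distribHaarChar : ∃ α : (LocalRing L v)ˣ, 1 < distribHaarChar (LocalRing L v) α := by
  obtain ⟨w⟩ : Nonempty (PlacesOver L v) := inferInstance
  have hw := hns w
  obtain ⟨ϖ, hϖ⟩ := F0P3cStCharTSTorusRay.exists_uniformizer_units L v
  have hlt : unitModulusChar (LocalRing L v) ϖ < 1 :=
    (unitModulusChar_lt_one_iff L v w hw ϖ).2 (by rw [hϖ w, ← WithZero.exp_zero]; exact WithZero.exp_lt_exp.2 (by norm_num))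
  have hlt' : distribHaarChar (LocalRing L v) ϖ < 1 := hlt
  refine ⟨ϖ⁻¹, ?_⟩
  rw [map_inv]
  exact one_lt_inv_iff₀.2 ⟨distribHaarChar_pos, hlt'⟩

omit [IsCMField L] in
/-- `‖u‖_R = nrm u` for a unit (★ DICT `prod_normAbs_units_mul` at `b = 1`, `prod_normAbs_one`). [cite: WeilBNT1967, Ch. I §2] -/
theorem prod_normAbs_units (u : (LocalRing L v)ˣ) :
    (∏ w' : PlacesOver L v, normAbs (w'.1.adicCompletion L) ((u : LocalRing L v) w')) = distribHaarChar (LocalRing L v) u := by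
  have h := prod_normAbs_units_mul L v u 1
  rw [mul_one, prod_normAbs_one, mul_one] at h
  exact h

include hns in
/-- **Points of `N(L⁺_v)` far out**: for every `A` there is `u ∈ N` with `nrm u₀₂ > A` — namely the chart point `u(0, y)` (★ `heisElt`, `u₀₂ = z(0, y) = y`) for the skew
element `y = (α ᾱ)^k δ` (`δ` a skew unit ★ `exists_conjLocal_skew_unit`, `α ᾱ` a `σ`-fixed unit of modulus `Q² > 1`, `k` large). [cite: Rogawski1990, §1.10 p. 9] [cite: WeilBNT1967, Ch. I §2] -/
theorem exists_norm_entry_gt (A : ℝ) :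
    ∃ u : ↥(cmBorelTriple L 3 v).N, A < ((∏ w' : PlacesOver L v, normAbs (w'.1.adicCompletion L)
      (((((u : ↥(unitaryGroupOfForm (conjLocal L (IsCMField.complexConj L) v) (cmLocalForm L 3 v))) : GL (Fin 3) (LocalRing L v)) :
        Matrix (Fin 3) (Fin 3) (LocalRing L v)) 0 2) w') : ℝ≥0) : ℝ) := by
  obtain ⟨w⟩ : Nonempty (PlacesOver L v) := inferInstance
  have hw := hns w
  letI : Invertible (2 : LocalRing L v) := (isUnit_two_localRing L v).invertible
  have hσ := conjLocal_conjLocal_cm L v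
  have hJ := cmLocalForm_eq_over L 3 v
  obtain ⟨δ, hδ⟩ := exists_conjLocal_skew_unit L v
  obtain ⟨α, hQ⟩ := exists_units_one_lt_distribHaarChar L v hns
  -- the `σ`-fixed unit `l = α σα` of modulus `Q · Q > 1`
  have hσα : distribHaarChar (LocalRing L v) (Units.map (conjLocal L (IsCMField.complexConj L) v : LocalRing L v →* LocalRing L v) α) =
      distribHaarChar (LocalRing L v) α := by
    rw [← prod_normAbs_units L v, ← prod_normAbs_units L v, Units.coe_map, MonoidHom.coe_coe, prod_normAbs_conjLocal L v w hw]
  have hl : conjLocal L (IsCMField.complexConj L) v ((α * Units.map (conjLocal L (IsCMField.complexConj L) v : LocalRing L v →* LocalRing L v) α : (LocalRing L v)ˣ) : LocalRing L v) =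
      (α * Units.map (conjLocal L (IsCMField.complexConj L) v : LocalRing L v →* LocalRing L v) α : (LocalRing L v)ˣ) := by
    rw [Units.val_mul, Units.coe_map, MonoidHom.coe_coe, map_mul, hσ, mul_comm]
  have hQl : 1 < (distribHaarChar (LocalRing L v) (α * Units.map (conjLocal L (IsCMField.complexConj L) v : LocalRing L v →* LocalRing L v) α) : ℝ) := by
    rw [map_mul, hσα, NNReal.coe_mul]
    exact one_lt_mul_of_lt_of_le (by exact_mod_cast hQ) (by exact_mod_cast hQ.le)
  -- `nrm δ > 0`, so `(Q·Q)^k · nrm δ > A` for `k` large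
  have hδpos : (0 : ℝ) < ((∏ w' : PlacesOver L v, normAbs (w'.1.adicCompletion L) ((δ : LocalRing L v) w') : ℝ≥0) : ℝ) := by
    rw [prod_normAbs_units L v δ]; exact_mod_cast distribHaarChar_pos
  obtain ⟨k, hk⟩ := pow_unbounded_of_one_lt (A / ((∏ w' : PlacesOver L v, normAbs (w'.1.adicCompletion L) ((δ : LocalRing L v) w') : ℝ≥0) : ℝ)) hQl
  -- the skew element `y = l^k δ` and the chart point `u(0, y)`
  set l : (LocalRing L v)ˣ := (α * Units.map (conjLocal L (IsCMField.complexConj L) v : LocalRing L v →* LocalRing L v) α) ^ k with hldef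
  have hlfix : conjLocal L (IsCMField.complexConj L) v (l : LocalRing L v) = l := by
    rw [hldef, Units.val_pow_eq_pow_val, map_pow, hl]
  have hy : (l : LocalRing L v) * (δ : LocalRing L v) ∈ skewPart (conjLocal L (IsCMField.complexConj L) v) :=
    mul_mem_skewPart (conjLocal L (IsCMField.complexConj L) v) hlfix ((mem_skewPart_iff _ _).2 hδ)
  refine ⟨heisElt (conjLocal L (IsCMField.complexConj L) v) hσ hJ 0 ⟨_, hy⟩, ?_⟩
  have hz : ((((heisElt (conjLocal L (IsCMField.complexConj L) v) hσ hJ 0 ⟨_, hy⟩ : ↥(cmBorelTriple L 3 v).N) :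
      ↥(unitaryGroupOfForm (conjLocal L (IsCMField.complexConj L) v) (cmLocalForm L 3 v))) : GL (Fin 3) (LocalRing L v)) :
        Matrix (Fin 3) (Fin 3) (LocalRing L v)) 0 2 = (l : LocalRing L v) * (δ : LocalRing L v) := by
    rw [← F0P3cStCharTSHeisenbergAnnulusSlice.heisZ_heisX_heisY (conjLocal L (IsCMField.complexConj L) v) hσ hJ, heisX_heisElt, heisY_heisElt, heisZ]
    simp
  rw [hz, prod_normAbs_units_mul L v l, NNReal.coe_mul, hldef, map_pow, NNReal.coe_pow]
  rwa [div_lt_iff₀ hδpos] at hk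

end CMPoints

/-! ## §2 A Haar-measure lemma on `N(L⁺_v)`: `c · ‖u₀₂‖⁻¹` far out (`c ≠ 0`) is incompatible with vanishing annulus integrals -/

section Annuli

variable (L : Type) [Field L] [NumberField L] [IsCMField L] (v : HeightOneSpectrum (𝓞 ↥(maximalRealSubfield L)))
  (hns : ∀ w : PlacesOver L v, IsCMField.complexConj L • w.1 = w.1)

include hns in
set_option maxHeartbeats 3200000 in
-- statement-heavy: three copies of the norm-of-entry expression over the unitary-group carrier
/-- **A large annulus on which `F = c · ‖u₀₂‖⁻¹` with `∫_{S_A} F dμ = 0` is `μ`-null** (`S_A = {A/Q² < ‖u₀₂‖ ≤ A}` lies in the compact ball ★ `isCompact_normBall`, so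
`0 = ∫_{S_A} ‖u₀₂‖⁻¹ ≥ μ(S_A)/A`). [cite: Casselman1995, §6.3] [cite: WeilBNT1967, Ch. I §2] -/
theorem measure_annulus_eq_zero_of_setIntegral_eq_zero
    [MeasurableSpace ↥(cmBorelTriple L 3 v).N] [BorelSpace ↥(cmBorelTriple L 3 v).N] (μ : Measure ↥(cmBorelTriple L 3 v).N) [μ.IsHaarMeasure]
    (F : ↥(cmBorelTriple L 3 v).N → ℂ) (c : ℂ) (hc : c ≠ 0) {Q A₀ A : ℝ} (hQ : 1 < Q) (hA : 0 < A) (hA₀ : A₀ ≤ A / Q ^ 2)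
    (hfar : ∀ u : ↥(cmBorelTriple L 3 v).N, A₀ < ((∏ w' : PlacesOver L v, normAbs (w'.1.adicCompletion L)
        (((((u : ↥(unitaryGroupOfForm (conjLocal L (IsCMField.complexConj L) v) (cmLocalForm L 3 v))) : GL (Fin 3) (LocalRing L v)) :
          Matrix (Fin 3) (Fin 3) (LocalRing L v)) 0 2) w') : ℝ≥0) : ℝ) →
      F u = c * ((((∏ w' : PlacesOver L v, normAbs (w'.1.adicCompletion L)
        (((((u : ↥(unitaryGroupOfForm (conjLocal L (IsCMField.complexConj L) v) (cmLocalForm L 3 v))) : GL (Fin 3) (LocalRing L v)) :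
          Matrix (Fin 3) (Fin 3) (LocalRing L v)) 0 2) w') : ℝ≥0) : ℝ)⁻¹ : ℝ) : ℂ))
    (hint : ∫ u in (fun u : ↥(cmBorelTriple L 3 v).N => ((∏ w' : PlacesOver L v, normAbs (w'.1.adicCompletion L)
        (((((u : ↥(unitaryGroupOfForm (conjLocal L (IsCMField.complexConj L) v) (cmLocalForm L 3 v))) : GL (Fin 3) (LocalRing L v)) :
          Matrix (Fin 3) (Fin 3) (LocalRing L v)) 0 2) w') : ℝ≥0) : ℝ)) ⁻¹' Set.Ioc (A / Q ^ 2) A, F u ∂μ = 0) :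
    μ ((fun u : ↥(cmBorelTriple L 3 v).N => ((∏ w' : PlacesOver L v, normAbs (w'.1.adicCompletion L)
        (((((u : ↥(unitaryGroupOfForm (conjLocal L (IsCMField.complexConj L) v) (cmLocalForm L 3 v))) : GL (Fin 3) (LocalRing L v)) :
          Matrix (Fin 3) (Fin 3) (LocalRing L v)) 0 2) w') : ℝ≥0) : ℝ)) ⁻¹' Set.Ioc (A / Q ^ 2) A) = 0 := by
  -- notation `r u = nrm u₀₂`, `S = S_A`
  set r : ↥(cmBorelTriple L 3 v).N → ℝ := fun u => ((∏ w' : PlacesOver L v, normAbs (w'.1.adicCompletion L)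
        (((((u : ↥(unitaryGroupOfForm (conjLocal L (IsCMField.complexConj L) v) (cmLocalForm L 3 v))) : GL (Fin 3) (LocalRing L v)) :
          Matrix (Fin 3) (Fin 3) (LocalRing L v)) 0 2) w') : ℝ≥0) : ℝ) with hrdef
  have hrc : Continuous r := F0P3cStCharTSKeys3AnnulusDock.continuous_norm_entry L v
  set S : Set ↥(cmBorelTriple L 3 v).N := r ⁻¹' Set.Ioc (A / Q ^ 2) A with hSdef
  have hQ2 : (0 : ℝ) < Q ^ 2 := by positivity
  have hAQ : 0 < A / Q ^ 2 := div_pos hA hQ2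
  have hS : MeasurableSet S := hrc.measurable measurableSet_Ioc
  have hSK : S ⊆ {u | r u ≤ A} := fun u hu => hu.2
  have hfin : μ S < ⊤ := lt_of_le_of_lt (measure_mono hSK) (F0P3cStCharTSKeys3AnnulusDock.isCompact_normBall L v hns A).measure_lt_top
  -- on `S`: `F = c · r⁻¹`, `r > A/Q² ≥ A₀`, `A⁻¹ ≤ r⁻¹ ≤ (A/Q²)⁻¹`
  have hrS : ∀ u ∈ S, A / Q ^ 2 < r u ∧ r u ≤ A := fun u hu => hu
  have hFS : ∀ u ∈ S, F u = c * (((r u)⁻¹ : ℝ) : ℂ) := fun u hu => hfar u (lt_of_le_of_lt hA₀ (hrS u hu).1)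
  -- the real integral of `r⁻¹` over `S` vanishes
  have h0 : ∫ u in S, (r u)⁻¹ ∂μ = 0 := by
    have h1 : ∫ u in S, F u ∂μ = ∫ u in S, c * (((r u)⁻¹ : ℝ) : ℂ) ∂μ := setIntegral_congr_fun hS hFS
    rw [hint, integral_const_mul, integral_complex_ofReal] at h1
    have h2 := (mul_eq_zero.1 h1.symm).resolve_left hc
    exact_mod_cast h2
  -- `r⁻¹` is integrable on `S` (bounded by `(A/Q²)⁻¹` on a set of finite measure) and `≥ A⁻¹` there
  have hintr : IntegrableOn (fun u => (r u)⁻¹) S μ := by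
    refine Measure.integrableOn_of_bounded (M := (A / Q ^ 2)⁻¹) hfin.ne (hrc.measurable.inv.aestronglyMeasurable) ?_
    rw [ae_restrict_iff' hS]
    refine Filter.Eventually.of_forall fun u hu => ?_
    have hru : 0 < r u := lt_trans hAQ (hrS u hu).1
    rw [Real.norm_of_nonneg (inv_nonneg.2 hru.le)]
    exact inv_anti₀ hAQ (hrS u hu).1.le
  have hle : ∫ u in S, A⁻¹ ∂μ ≤ ∫ u in S, (r u)⁻¹ ∂μ :=
    setIntegral_mono_on (integrableOn_const (C := A⁻¹) hfin.ne enorm_ne_top) hintr hS fun u hu =>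
      inv_anti₀ (lt_trans hAQ (hrS u hu).1) (hrS u hu).2
  rw [h0, setIntegral_const, smul_eq_mul] at hle
  have hnonpos : μ.real S ≤ 0 := by
    by_contra hcon
    exact absurd hle (not_le.2 (mul_pos (lt_of_not_ge hcon) (inv_pos.2 hA)))
  exact (measureReal_eq_zero_iff hfin.ne).1 (le_antisymm hnonpos measureReal_nonneg)

include hns in
set_option maxHeartbeats 3200000 in
-- statement-heavy (as above)
/-- **«NO VANISHING ANNULI FOR A POSITIVE FAR-OUT INTEGRAND».**  `μ` a Haar measure of `N(L⁺_v)` (`v` non-split), `Q > 1`, `F : N → ℂ` with `F(u) = c · ‖u₀₂‖⁻¹` whenever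
`‖u₀₂‖ > A₀`, `c ≠ 0`; then the annulus integrals `∫_{A/Q² < ‖u₀₂‖ ≤ A} F dμ` cannot all vanish for `A ≥ A₁`.  (Each large annulus is null by
`measure_annulus_eq_zero_of_setIntegral_eq_zero`; the open set `{A⋆ < ‖u₀₂‖}` is a countable union of them (Mathlib `exists_mem_Ioc_zpow`), non-empty by `exists_norm_entry_gt`, and
open non-empty sets have positive Haar measure.) [cite: Keys1984, §7 Thm. (1) p. 126] [cite: Casselman1995, §6.3–§6.4] [cite: WeilBNT1967, Ch. I §2] -/
theorem false_of_annulus_integrals_eq_zero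
    [MeasurableSpace ↥(cmBorelTriple L 3 v).N] [BorelSpace ↥(cmBorelTriple L 3 v).N] (μ : Measure ↥(cmBorelTriple L 3 v).N) [μ.IsHaarMeasure]
    (F : ↥(cmBorelTriple L 3 v).N → ℂ) (c : ℂ) (hc : c ≠ 0) {Q A₀ A₁ : ℝ} (hQ : 1 < Q)
    (hfar : ∀ u : ↥(cmBorelTriple L 3 v).N, A₀ < ((∏ w' : PlacesOver L v, normAbs (w'.1.adicCompletion L)
        (((((u : ↥(unitaryGroupOfForm (conjLocal L (IsCMField.complexConj L) v) (cmLocalForm L 3 v))) : GL (Fin 3) (LocalRing L v)) :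
          Matrix (Fin 3) (Fin 3) (LocalRing L v)) 0 2) w') : ℝ≥0) : ℝ) →
      F u = c * ((((∏ w' : PlacesOver L v, normAbs (w'.1.adicCompletion L)
        (((((u : ↥(unitaryGroupOfForm (conjLocal L (IsCMField.complexConj L) v) (cmLocalForm L 3 v))) : GL (Fin 3) (LocalRing L v)) :
          Matrix (Fin 3) (Fin 3) (LocalRing L v)) 0 2) w') : ℝ≥0) : ℝ)⁻¹ : ℝ) : ℂ))
    (hann : ∀ A : ℝ, A₁ ≤ A → ∫ u in (fun u : ↥(cmBorelTriple L 3 v).N => ((∏ w' : PlacesOver L v, normAbs (w'.1.adicCompletion L)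
        (((((u : ↥(unitaryGroupOfForm (conjLocal L (IsCMField.complexConj L) v) (cmLocalForm L 3 v))) : GL (Fin 3) (LocalRing L v)) :
          Matrix (Fin 3) (Fin 3) (LocalRing L v)) 0 2) w') : ℝ≥0) : ℝ)) ⁻¹' Set.Ioc (A / Q ^ 2) A, F u ∂μ = 0) :
    False := by
  set r : ↥(cmBorelTriple L 3 v).N → ℝ := fun u => ((∏ w' : PlacesOver L v, normAbs (w'.1.adicCompletion L)
        (((((u : ↥(unitaryGroupOfForm (conjLocal L (IsCMField.complexConj L) v) (cmLocalForm L 3 v))) : GL (Fin 3) (LocalRing L v)) :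
          Matrix (Fin 3) (Fin 3) (LocalRing L v)) 0 2) w') : ℝ≥0) : ℝ) with hrdef
  have hrc : Continuous r := F0P3cStCharTSKeys3AnnulusDock.continuous_norm_entry L v
  have hQ2 : (1 : ℝ) < Q ^ 2 := by nlinarith
  have hQ2pos : (0 : ℝ) < Q ^ 2 := by positivity
  -- the threshold `A⋆`: positive, `≥ A₁`, and `A⋆/Q² ≥ A₀`
  set Astar : ℝ := max A₁ (max 1 ((max A₀ 0 + 1) * Q ^ 2)) with hAstar
  have hAstar_pos : 0 < Astar := lt_of_lt_of_le one_pos (le_trans (le_max_left _ _) (le_max_right _ _))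
  have hAstar₁ : A₁ ≤ Astar := le_max_left _ _
  have hAstar₀ : (max A₀ 0 + 1) * Q ^ 2 ≤ Astar := le_trans (le_max_right _ _) (le_max_right _ _)
  -- Step 1: every annulus `S_B` with `B ≥ A⋆` is null
  have hnull : ∀ B : ℝ, Astar ≤ B → μ (r ⁻¹' Set.Ioc (B / Q ^ 2) B) = 0 := by
    intro B hB
    have hBpos : 0 < B := lt_of_lt_of_le hAstar_pos hB
    have hB₀ : A₀ ≤ B / Q ^ 2 := by
      rw [le_div_iff₀ hQ2pos]
      have : A₀ ≤ max A₀ 0 := le_max_left _ _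
      nlinarith
    exact measure_annulus_eq_zero_of_setIntegral_eq_zero L v hns μ F c hc hQ hBpos hB₀ hfar (hann B (le_trans hAstar₁ hB))
  -- Step 2: the open set `{A⋆ < r}` is null (a countable union of annuli `S_{A⋆ (Q²)^(k+1)}`)
  have hO : μ {u | Astar < r u} = 0 := by
    refine measure_mono_null (fun u hu => ?_) (measure_iUnion_null fun k : ℕ => hnull (Astar * (Q ^ 2) ^ (k + 1))
      (le_mul_of_one_le_right hAstar_pos.le (one_le_pow₀ hQ2.le)))
    have hρ : Astar < r u := hu
    have hρpos : 0 < r u := lt_trans hAstar_pos hρ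
    obtain ⟨n, hn⟩ := exists_mem_Ioc_zpow (div_pos hρpos hAstar_pos) hQ2
    -- `n ≥ 0` since `r u / A⋆ > 1`
    have hn0 : 0 ≤ n := by
      by_contra hneg
      have hle : (Q ^ 2) ^ (n + 1) ≤ 1 := zpow_le_one_of_nonpos₀ hQ2.le (by omega)
      have hgt : 1 < r u / Astar := by rw [lt_div_iff₀ hAstar_pos, one_mul]; exact hρ
      exact absurd (lt_of_le_of_lt hle (lt_of_lt_of_le hgt hn.2)) (lt_irrefl _)
    obtain ⟨k, rfl⟩ := Int.eq_ofNat_of_zero_le hn0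
    rw [zpow_natCast, ← Nat.cast_succ, zpow_natCast] at hn
    have hlo : Astar * (Q ^ 2) ^ k < r u := (lt_div_iff₀' hAstar_pos).1 hn.1
    have hhi : r u ≤ Astar * (Q ^ 2) ^ (k + 1) := (div_le_iff₀' hAstar_pos).1 hn.2
    refine Set.mem_iUnion.2 ⟨k, ?_⟩
    change Astar * (Q ^ 2) ^ (k + 1) / Q ^ 2 < r u ∧ r u ≤ Astar * (Q ^ 2) ^ (k + 1)
    refine ⟨?_, hhi⟩
    rwa [pow_succ, ← mul_assoc, mul_div_cancel_right₀ _ hQ2pos.ne']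
  -- Step 3: but it is open and non-empty
  have hopen : IsOpen {u | Astar < r u} := isOpen_lt continuous_const hrc
  obtain ⟨u, hu⟩ := exists_norm_entry_gt L v hns Astar
  exact (hopen.measure_pos μ ⟨u, hu⟩).ne' hO

end Annuli

/-! ## §3 The socket's first conjunct: a reducible irregular `i_G(χ₁, χ₂)` has `χ₁ ≠ 1` -/

section Socket

variable (L : Type) [Field L] [NumberField L] [IsCMField L] (v : HeightOneSpectrum (𝓞 ↥(maximalRealSubfield L)))
  (hns : ∀ w : PlacesOver L v, IsCMField.complexConj L • w.1 = w.1)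

include hns in
set_option synthInstance.maxHeartbeats 400000 in
set_option maxHeartbeats 8000000 in
-- statement∕proof-heavy: the `SmoothInd` carrier of ★ `cmPrincipalSeries` (class of ★ `hSecond_holds` ∕ ★ D1 ∕ ★ D2A ∕ ★ B4); the goal is `False` from `intro`, so `obtain` is cheap
/-- **`χ₁ ≠ 1` for a reducible irregular principal series** — the FIRST conjunct of the socket `sig_K2E3IrregularReducibleCaseThree` under its exact binders: at a non-split `v`,
for continuous `χ₁, χ₂` with `(χ₁, χ₂) = w(χ₁, χ₂)`, if `i_G(χ₁, χ₂)` has a `G`-stable `⊥ ≠ N ≠ ⊤` then `χ₁ ≠ 1`; equivalently `i_G(1, χ₂) = (χ₂ ∘ det) ⊗ i_G(1)` is IRREDUCIBLE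
(Keys: «`Ind_P^G λ` is reducible if and only if `λ ≠ 1`, `wλ = λ`, and `λ|F^× = 1`», the clause `λ ≠ 1`).  Proof: ★ helper 1 (`r_B = χ · id`) ⟹ ★ D1 (all cell integrals vanish) ⟹
★ D2A at `m = d(α, ᾱα⁻¹, ᾱ⁻¹)`, `‖α‖ > 1` (all large annulus integrals of `F = f₀(w₀ ·)` vanish) ⟹ ★ B4 (`F = χ₂(−1) · ‖u₀₂‖⁻¹` far out, as `χ₁ = 1`, `f₀(1) = 1`) ⟹ §2.
[cite: Keys1984, §7 Thm. (1) p. 126] [cite: Rogawski1990, §12.2 (3) pp. 173–174] [cite: Casselman1995, §6.3–§6.4, Lemma 7.1.1 (a)] [cite: BernsteinZelevinsky1977, §2.3, §5 (5.2)] -/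
theorem chiOne_ne_one_of_reducible_irregular
    (χ₁ : (UnitaryGroup.LocalRing L v)ˣ →* ℂˣ) (χ₂ : ↥(normOneUnits (conjLocal L (IsCMField.complexConj L) v)) →* ℂˣ)
    (h₁ : Continuous (fun x => ((χ₁ x : ℂˣ) : ℂ))) (h₂ : Continuous (fun x => ((χ₂ x : ℂˣ) : ℂ)))
    (hirr : UnitaryGroup.cmTorusCharPair L v χ₁ χ₂ = UnitaryGroup.cmTorusCharPair L v (UnitaryGroup.conjInvChar (conjLocal L (IsCMField.complexConj L) v) χ₁) χ₂)
    (hred : ∃ N : Subrepresentation (UnitaryGroup.cmPrincipalSeries L 3 v (UnitaryGroup.cmTorusCharPair L v χ₁ χ₂)), N ≠ ⊥ ∧ N ≠ ⊤) :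
    χ₁ ≠ 1 := by
  intro hχ
  -- point-set ∕ measure structure (as ★ `hSecond_holds`)
  haveI := locallyCompactSpace_cmBorelU L 3 v
  haveI : LocallyCompactSpace ↥(unitaryGroupOfForm (conjLocal L (IsCMField.complexConj L) v) (cmLocalForm L 3 v)) := locallyCompactSpace_local (IsCMField.complexConj L) 3 _ v
  haveI : SecondCountableTopology (LocalRing L v) := secondCountableTopology_localRing (E := L) v
  letI : MeasurableSpace (LocalRing L v) := borel _
  haveI : BorelSpace (LocalRing L v) := ⟨rfl⟩
  letI : Invertible (2 : LocalRing L v) := (isUnit_two_localRing L v).invertible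
  letI : MeasurableSpace ↥(cmBorelTriple L 3 v).N := borel _
  haveI : BorelSpace ↥(cmBorelTriple L 3 v).N := ⟨rfl⟩
  haveI := locallyCompactSpace_skewPart (conjLocal L (IsCMField.complexConj L) v) (continuous_conjLocal L (IsCMField.complexConj L) v)
  obtain ⟨w⟩ : Nonempty (PlacesOver L v) := inferInstance
  have hw := hns w
  -- a Haar measure on `N(L⁺_v)` (★ `heisHaar`)
  obtain ⟨μ, hμ⟩ : ∃ μ : Measure ↥(cmBorelTriple L 3 v).N, μ.IsHaarMeasure :=
    ⟨_, isHaarMeasure_heisHaar (conjLocal L (IsCMField.complexConj L) v) (conjLocal_conjLocal_cm L v) (continuous_conjLocal L (IsCMField.complexConj L) v)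
      (cmLocalForm_eq_over L 3 v) (Measure.addHaar : Measure (LocalRing L v)) (Measure.addHaar : Measure ↥(skewPart (conjLocal L (IsCMField.complexConj L) v)))⟩
  haveI := hμ
  -- the Weyl element, the standard section `f₀` (`f₀(1) = 1`), `wχ = χ`
  obtain ⟨w₀, hw₀⟩ := F0P3U3PrincipalSeriesOpenCellTorusChar.exists_weylElt_three L v hns
  obtain ⟨f₀, hf₀, -⟩ := (exists_cmPrincipalSeries_cmTorusCharPair_toFun_one_eq_one L v χ₁ χ₂ h₁ h₂).1
  have hw' : cmWeylTorusCharPair L v χ₁ χ₂ = cmTorusCharPair L v χ₁ χ₂ := (cmWeylTorusCharPair_eq L v χ₁ χ₂).trans hirr.symm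
  -- ★ helper 1: `r_B = χ · id`
  have hscalar := K2E3IrregularReducibleCaseThreeJacquetScalar.normalizedJacquet_eq_smul_of_reducible_irregular L v hns χ₁ χ₂ h₁ h₂ hirr hred
  -- the torus element `m = d(α, ᾱα⁻¹, ᾱ⁻¹)` with `Q = ‖α‖ > 1`
  obtain ⟨α, hQ⟩ := exists_units_one_lt_distribHaarChar L v hns
  obtain ⟨m, d, hd, hd0⟩ := exists_torus_diag (conjLocal L (IsCMField.complexConj L) v) (conjLocal_conjLocal_cm L v) (cmLocalForm L 3 v) (cmLocalForm_eq_over L 3 v) α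
  have hQ' : 1 < distribHaarChar (LocalRing L v) (d 0) := by rw [hd0]; exact hQ
  have hQr : (1 : ℝ) < (distribHaarChar (LocalRing L v) (d 0) : ℝ) := by exact_mod_cast hQ'
  -- ★ D2A: the cell integral of `g₀(m)` is `−χ(m) •` the annulus integral, for `A ≥ A₁`
  obtain ⟨A₁, hA₁⟩ := F0P3cStCharTSKeys3AnnulusDock.integral_cellFun_sub_eq_neg_smul_setIntegral_annulus L v hns χ₁ χ₂ w₀ hw₀ μ hw' m hd hQ' f₀
  -- ★ B4: the far-out threshold
  obtain ⟨A₀, hA₀⟩ := F0P3cStCharTSCellFunFarOut.exists_toFun_weylElt_mul_eq_smul_toFun_one L v hns χ₁ χ₂ w₀ hw₀ f₀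
  have hχ1 : ∀ x, χ₁ x = 1 := fun x => by rw [hχ, MonoidHom.one_apply]
  refine false_of_annulus_integrals_eq_zero L v hns μ
    (fun u => f₀.toFun (w₀ * (u : ↥(unitaryGroupOfForm (conjLocal L (IsCMField.complexConj L) v) (cmLocalForm L 3 v)))))
    (((χ₂ ⟨-1, F0P3cStCharTSBigCellFactorisation.neg_one_mem_normOneUnits (conjLocal L (IsCMField.complexConj L) v)⟩ : ℂˣ) : ℂ)) (Units.ne_zero _)
    (A₀ := (A₀ : ℝ)) (A₁ := A₁) hQr
    (fun u hu => ?_) (fun A hA => ?_)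
  · -- far out: `F(u) = χ₂(−1) · ‖u₀₂‖⁻¹` (★ B4 with `χ₁ = 1`, `f₀(1) = 1`)
    beta_reduce
    have hpos : (0 : ℝ) < ((∏ w' : PlacesOver L v, normAbs (w'.1.adicCompletion L)
        (((((u : ↥(unitaryGroupOfForm (conjLocal L (IsCMField.complexConj L) v) (cmLocalForm L 3 v))) : GL (Fin 3) (LocalRing L v)) :
          Matrix (Fin 3) (Fin 3) (LocalRing L v)) 0 2) w') : ℝ≥0) : ℝ) := lt_of_le_of_lt A₀.coe_nonneg hu
    have hne0 : (((u : ↥(unitaryGroupOfForm (conjLocal L (IsCMField.complexConj L) v) (cmLocalForm L 3 v))) : GL (Fin 3) (LocalRing L v)) :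
        Matrix (Fin 3) (Fin 3) (LocalRing L v)) 0 2 ≠ 0 := by
      intro h0
      rw [h0, (prod_normAbs_eq_zero_iff L v w hw 0).2 rfl, NNReal.coe_zero] at hpos
      exact lt_irrefl _ hpos
    have hb := (isUnit_iff_ne_zero_localRing L v w hw _).2 hne0
    have hmod : unitModulusChar (LocalRing L v) hb.unit = ∏ w' : PlacesOver L v, normAbs (w'.1.adicCompletion L)
        ((((u : ↥(unitaryGroupOfForm (conjLocal L (IsCMField.complexConj L) v) (cmLocalForm L 3 v))) : GL (Fin 3) (LocalRing L v)) :
          Matrix (Fin 3) (Fin 3) (LocalRing L v)) 0 2 w') := by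
      rw [unitModulusChar_localRing_eq_prod, hb.unit_spec]
    have hle : A₀ ≤ unitModulusChar (LocalRing L v) hb.unit := by
      rw [← NNReal.coe_le_coe, hmod]; exact hu.le
    rw [hA₀ u hb hle, hχ1, inv_one, Units.val_one, one_mul, hf₀, smul_eq_mul, mul_one, hmod, NNReal.coe_inv]
  · -- annulus: `0 = ∫ g₀(m)(w₀ ·) = −χ(m) • ∫_{S_A} F` (★ D1 ⟸ ★ helper 1, ★ D2A), and `χ(m) ≠ 0`
    beta_reduce
    have h := hA₁ A hA
    rw [(F0P3cStCharTSKeys3SplitTestDatum.pair_normalizedJacquet_mk_eq_smul_iff_integral_cellFun_eq_zero L v hns χ₁ χ₂ h₁ h₂ w₀ hw₀ μ m f₀).1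
      (hscalar m _)] at h
    have h' := neg_eq_zero.1 h.symm
    exact (smul_eq_zero.1 h').resolve_left (Units.ne_zero _)

end Socket

end Summit.HodgeConjecture.HodgeConjecture.Cruxes.H413.K2E3IrregularReducibleCaseThreeChiOneNeOne

end
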